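import Summits.CriticalPhenomena.PercolationContinuityZ3.Theorems.SahiMasterFamilyThirdFreeRecursion
import Summits.CriticalPhenomena.PercolationContinuityZ3.Theorems.SahiMasterFamilyMixedRectangle
import HarnessLib

/-!
# Kahn/Sahi `C₃` for all triangle-graphical triples follows from the generalised two-rectangle inequality (GT')

Unit `prim-master-conj` (crux anchor stmt-CriticalPhenomena-4575, helper work), gen 38; memo
`run/shared/lean/prim/prim-l12/FROM-prim-master-conj-g38-TRIANGLE-RECURSION.md` (3) and `prim-master-conj/POINTWISE.md` §39.

A triple of increasing events `U₀, U₁, U₂` is TRIANGLE-GRAPHICAL if `U₀` is determined by a coordinate set `S`, `U₁` by `T`,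
`U₂` by `R`, and no coordinate is common to all three: `(S ∩ T) ∩ R = ∅` (the family `f(x,y), g(x,z), h(y,z)`).
The one-coordinate recursion `ThirdFreeRecursion.sahiE_three_nonneg_of_third_free` (sections at a coordinate
`e ∈ S ∩ T`, of which `U₂` is free) reduces Sahi's `E_3(μ_p; 1_{U₀},1_{U₁},1_{U₂}) ≥ 0` for such a triple to the same
statement for the two `e`-minors (again triangle-graphical, with `|S ∩ T|` one smaller) plus the GENERALISED TWO-RECTANGLE
INEQUALITY (GT') for the nested pair of minors:
`E_3(U⁰) + E_3(U¹) ≥ μ⟦U₂⟧δε − δ(μ⟦U₁¹∩U₂⟧ − μ⟦U₁⁰∩U₂⟧) − ε(μ⟦U₀¹∩U₂⟧ − μ⟦U₀⁰∩U₂⟧)`, `δ = μ⟦U₀¹⟧ − μ⟦U₀⁰⟧`,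
`ε = μ⟦U₁¹⟧ − μ⟦U₁⁰⟧`.  The base case `S ∩ T = ∅` is gen 37's `MixedRectangle.sahiE_three_ind_nonneg_of_supports`.

THEOREM (`sahiE_three_ind_nonneg_of_GT`, CONDITIONAL): if (GT') holds for every triangle-graphical triple and every
`e ∈ S ∩ T`, then `E_3(μ_p) ≥ 0` for every triangle-graphical triple — by induction on `|S ∩ T|`.
HONEST FRAMING: (GT') is this programme's conjecture (census-clean; proved for `|S ∩ T| ≤ 2` via the orbit sums (Ψ₁), (Ψ₂):
`MixedRectangle`, `CrossOrbitTriangle`), NOT a published fact; it enters as an explicit hypothesis.  Kahn's Conjecture 5 /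
Sahi's `C₃` remain OPEN. [this work]
-/

noncomputable section

open scoped Classical

namespace Summit.CriticalPhenomena.PercolationContinuityZ3.Theorems

namespace TriangleOfGT

open Finset Function
open Literature.Combinatorics.Sahi2008
open Literature.Probability.Percolation (DeterminedBy determinedBy_iff)
open Literature.Probability.Percolation.DecisionTree (ind ind_nonneg ind_of_mem ind_of_not_mem)

variable {ι : Type} [Fintype ι]

local notation3 (prettyPrint := false) "μ⟦" q ", " X "⟧" => ex (bernoulliWeight q) (ind X)

omit [Fintype ι] in
/-- An event determined by coordinates not containing `e` is its own `e`-section. [folklore] -/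
theorem secAt_eq_self_of_determinedBy_finset {V : Set (Set ι)} {R : Finset ι} (hV : DeterminedBy V (↑R : Set ι))
    {e : ι} (he : e ∉ R) (c : Bool) : secAt e c V = V := by
  ext ω
  rw [mem_secAt]
  exact (determinedBy_iff V (↑R : Set ι)).1 hV _ _
    (forceAt_inter_of_notMem c ω (fun h => he (Finset.mem_coe.1 h)))

/-- On an empty index type every third Sahi functional of the product weight vanishes (one configuration of mass `1`).
[folklore] -/
theorem sahiE_three_eq_zero_of_isEmpty [IsEmpty ι] (p : ι → unitInterval) (F : Fin 3 → Set ι → ℝ) :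
    sahiE (bernoulliWeight p) 3 F = 0 := by
  have hw : bernoulliWeight p (default : Set ι) = 1 := by
    have h := sum_bernoulliWeight p
    rwa [Fintype.sum_unique] at h
  rw [sahiE_three_apply]
  simp only [ex_def, Fintype.sum_unique, hw, one_mul, Pi.mul_apply]
  ring

/-- **Triangle-graphical `C₃` from (GT') (conditional).**  Suppose the generalised two-rectangle inequality (GT') holds
for every triple of increasing events `V₀, V₁, V₂` determined by `S, T, R` with `Disjoint (S ∩ T) R` and every
`e ∈ S ∩ T` (sections `V^c_j = secAt e c (V j)`):
`μ⟦V₂⟧δε − δ(μ⟦V₁¹∩V₂⟧ − μ⟦V₁⁰∩V₂⟧) − ε(μ⟦V₀¹∩V₂⟧ − μ⟦V₀⁰∩V₂⟧) ≤ E_3(μ_p; V⁰) + E_3(μ_p; V¹)`.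
Then `E_3(μ_p; 1_{U₀}, 1_{U₁}, 1_{U₂}) ≥ 0` for every such triple `U`.  Proof: induction on `|S ∩ T|` with the exact
recursion `ThirdFreeRecursion.sahiE_three_nonneg_of_third_free`; base `MixedRectangle.sahiE_three_ind_nonneg_of_supports`.
[this work] -/
theorem sahiE_three_ind_nonneg_of_GT (p : ι → unitInterval)
    (hGT : ∀ (e : ι) (V : Fin 3 → Set (Set ι)) (S T R : Finset ι), (∀ j, IsUpperSet (V j)) →
      DeterminedBy (V 0) (↑S : Set ι) → DeterminedBy (V 1) (↑T : Set ι) → DeterminedBy (V 2) (↑R : Set ι) →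
      e ∈ S ∩ T → Disjoint (S ∩ T) R →
      μ⟦p, V 2⟧ * (μ⟦p, secAt e true (V 0)⟧ - μ⟦p, secAt e false (V 0)⟧)
            * (μ⟦p, secAt e true (V 1)⟧ - μ⟦p, secAt e false (V 1)⟧)
          - (μ⟦p, secAt e true (V 0)⟧ - μ⟦p, secAt e false (V 0)⟧)
            * (μ⟦p, secAt e true (V 1) ∩ V 2⟧ - μ⟦p, secAt e false (V 1) ∩ V 2⟧)
          - (μ⟦p, secAt e true (V 1)⟧ - μ⟦p, secAt e false (V 1)⟧)
            * (μ⟦p, secAt e true (V 0) ∩ V 2⟧ - μ⟦p, secAt e false (V 0) ∩ V 2⟧)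
        ≤ sahiE (bernoulliWeight p) 3 (fun j => ind (secAt e false (V j)))
          + sahiE (bernoulliWeight p) 3 (fun j => ind (secAt e true (V j))))
    {U : Fin 3 → Set (Set ι)} (hU : ∀ j, IsUpperSet (U j)) {S T R : Finset ι}
    (hS : DeterminedBy (U 0) (↑S : Set ι)) (hT : DeterminedBy (U 1) (↑T : Set ι))
    (hR : DeterminedBy (U 2) (↑R : Set ι)) (hSTR : Disjoint (S ∩ T) R) :
    0 ≤ sahiE (bernoulliWeight p) 3 (fun j => ind (U j)) := by
  suffices main : ∀ (n : ℕ) (U : Fin 3 → Set (Set ι)) (S T : Finset ι), (S ∩ T).card = n →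
      (∀ j, IsUpperSet (U j)) → DeterminedBy (U 0) (↑S : Set ι) → DeterminedBy (U 1) (↑T : Set ι) →
      DeterminedBy (U 2) (↑R : Set ι) → Disjoint (S ∩ T) R →
      0 ≤ sahiE (bernoulliWeight p) 3 (fun j => ind (U j)) from main _ U S T rfl hU hS hT hR hSTR
  intro n
  induction n with
  | zero =>
    intro U S T hcard hU hS hT _ _
    have hST : S ∩ T = ∅ := Finset.card_eq_zero.1 hcard
    rcases isEmpty_or_nonempty ι with hι | ⟨⟨e⟩⟩
    · exact (sahiE_three_eq_zero_of_isEmpty p _).ge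
    · exact MixedRectangle.sahiE_three_ind_nonneg_of_supports p e hU hS hT (hST ▸ Finset.empty_subset _)
  | succ n ih =>
    intro U S T hcard hU hS hT hR hdis
    obtain ⟨e, he⟩ : (S ∩ T).Nonempty := Finset.card_pos.1 (by omega)
    have heR : e ∉ R := fun h => Finset.disjoint_left.1 hdis he h
    have hfree : ∀ c : Bool, secAt e c (U 2) = U 2 := fun c => secAt_eq_self_of_determinedBy_finset hR heR c
    have hmin : ∀ c : Bool, 0 ≤ sahiE (bernoulliWeight p) 3 (fun j => ind (secAt e c (U j))) := by
      intro c
      refine ih (fun j => secAt e c (U j)) (S.erase e) (T.erase e) ?_ (fun j => isUpperSet_secAt e c (hU j))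
        (determinedBy_secAt e c hS) (determinedBy_secAt e c hT) ?_ ?_
      · rw [Finset.erase_inter, Finset.inter_erase, Finset.erase_idem, Finset.card_erase_of_mem he, hcard]
        rfl
      · show DeterminedBy (secAt e c (U 2)) (↑R : Set ι)
        rw [hfree c]
        exact hR
      · exact hdis.mono_left (Finset.inter_subset_inter (Finset.erase_subset e S) (Finset.erase_subset e T))
    exact ThirdFreeRecursion.sahiE_three_nonneg_of_third_free p e hfree (hmin false) (hmin true)
      (hGT e U S T R hU hS hT hR he hdis)

end TriangleOfGT

end Summit.CriticalPhenomena.PercolationContinuityZ3.Theorems
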